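import Literature.NumberTheory.EllipticCurves.Rank1Residual.X9CMPartner
import Literature.NumberTheory.EllipticCurves.Rank1Residual.X9SmallImage
import HarnessLib

/-!
# The small-image obstruction (irreducible, NON-surjective `ρ̄_{E,p}`) is invariant under mod-`p`
# congruences: no congruent partner escapes O8 / X9 / X10b (cell `b2b-bsdres`, team n1011,
# OWNERS T-O8 image strand, seat `b2b-bsdres-n1011-p04`)

HONEST FRAMING (cell `b2b-bsdres`, run/shared/lean/b2b/bsd-rank1-residual/, verbatim in every
file): the goal of the cell is to DELETE the COMBINATION-SHAPED residual classes of the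
Birch–Swinnerton-Dyer formula for ALL analytic-rank `≤ 1` elliptic curves over `ℚ` — "full BSD
formula for every rank `≤ 1` curve in class `C`" assembled STRICTLY from published theorems — so
that the rank-`≤ 1` remainder becomes exactly the CONSTRUCTION-SHAPED classes, which are TYPED
(missing-input `Prop`s), NOT attempted. This is not "finishing BSD". Team n1011, O8 image strand:
prove what is provable now; shrink each hard class to its core; no claim beyond stated classes.
THEOREMS ONLY (no definition, no named fact); nothing booked; O8 / X9 / X10b stay as labelled.

## What this file proves, and why

RESIDUAL-MAP §I O8 (E3): "isogeny/twist to surjective-image pairs is impossible (image is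
twist-invariant up to ±) → transport only via CONGRUENCES". This file closes that last door as far
as IMAGE hypotheses go: a mod-`p` congruence `E[p] ≃ E'[p]` of `Γ_ℚ`-modules transports
surjectivity of `ρ̄` in BOTH directions, so every congruent partner `E'` of an O8 / X9 / X10b curve —
a CM partner (x11a GEN 22), a level-lowered curve, a member of the same Hida branch — has again an
irreducible NON-surjective `ρ̄_{E',p}`, hence again no Kato (12.5.2), no Mazur–Rubin / Kato-13.4 (3)
/ BCS element (im). A congruence can therefore only IMPORT theorems that are valid for small
image (Rubin's CM main conjecture through Greenberg–Vatsal / Emerton–Pollack–Weston, as in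
`X11a/CMPartner.lean`), never a big-image Euler-system theorem; the O8 ideation target
(`cells/n1011/O8-IDEATION.md` §A) is sharpened accordingly.

* `hasSurjectiveModNGaloisRep_of_torsionIso` — a `Γ_ℚ`-equivariant additive isomorphism
  `e : E₁[n] ≃ E₂[n]` carries `ρ̄_{E₁,n}` onto ⟹ `ρ̄_{E₂,n}` onto (pull an automorphism of `E₂[n]`
  back along `e`, realise it by `σ`, push forward); `hasSurjectiveModNGaloisRep_iff_of_torsionIso`.
* `irr_and_not_surj_of_torsionIso` — `Irr ∧ ¬Surj` at `p` passes from `E₁` to `E₂`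
  (irreducibility: Greenberg–Vatsal 2000's `hasIrreducibleModPGaloisRep_of_torsionIso`).
* `not_bigIm_of_torsionIso` — hence `¬ BigIm E₂ p` (x9's `not_bigIm_of_irr_of_not_surj`): the
  congruent partner carries no useful Galois element either.
* `not_surj_of_torsionIso_of_hasCM_not_surj` — read the other way: a curve `E` with SURJECTIVE
  `ρ̄_{E,p}` (e.g. every N11 pair, `surj(3)`) is congruent mod `p` to NO curve with non-surjective
  `ρ̄` — in particular to no CM curve once "CM ⟹ `ρ̄_{A,p}` not onto" is supplied (a census bit /
  the tree's `cmTorsion_cartanImage` for large `p`); this is the kernel half of the lead's R3-9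
  remark that Kim 2025 Conj. 7.5's clause "not congruent to an anomalous ordinary CM form" is
  automatic on N11 (the CM-image half at `p = 3` is not a tree theorem and stays a binder).

References: J.-P. Serre, Invent. Math. 15 (1972) §2.4 Prop. 15 [Serre1972]; R. Greenberg,
V. Vatsal, Invent. Math. 142 (2000) (congruent curves) [GreenbergVatsal2000]; RESIDUAL-MAP §I O8;
cells/n1011/O8-IDEATION.md; cells/n1011/PLAN.md R3-9.
-/

noncomputable section

open scoped Classical

open WeierstrassCurve Literature.NumberTheory.EllipticCurves
  Literature.NumberTheory.EllipticCurves.Rank1Residual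

namespace Summit.BirchSwinnertonDyer.Rank1Residual.GaloisImage

/-- **Surjectivity of `ρ̄_{E,n}` is transported along a `Γ_ℚ`-equivariant isomorphism
`E₁[n] ≃ E₂[n]`.** Given `α ∈ Aut(E₂[n])`, the automorphism `e⁻¹ ∘ α ∘ e` of `E₁[n]` is `ρ̄_{E₁,n}(σ)`
for some `σ` (surjectivity), and equivariance gives `ρ̄_{E₂,n}(σ) = α`. [folklore] -/
theorem hasSurjectiveModNGaloisRep_of_torsionIso {W₁ W₂ : WeierstrassCurve ℚ} {n : ℤ}
    (e : geomTorsion W₁ n ≃+ geomTorsion W₂ n)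
    (he : ∀ (σ : Field.absoluteGaloisGroup ℚ) (P : geomTorsion W₁ n), e (σ • P) = σ • e P)
    (h : W₁.HasSurjectiveModNGaloisRep n) : W₂.HasSurjectiveModNGaloisRep n := by
  intro α
  obtain ⟨σ, hσ⟩ := h (Multiplicative.ofAdd ((e.trans (Multiplicative.toAdd α)).trans e.symm))
  refine ⟨σ, ?_⟩
  apply Multiplicative.toAdd.injective
  refine AddEquiv.ext fun Q ↦ ?_
  have h1 : σ • e.symm Q = e.symm ((Multiplicative.toAdd α) Q) := by
    have h2 := congrArg (fun β ↦ (Multiplicative.toAdd β) (e.symm Q)) hσ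
    simp only [galoisRepTorsion_apply, toAdd_ofAdd, AddEquiv.trans_apply,
      AddEquiv.apply_symm_apply] at h2
    exact h2
  rw [galoisRepTorsion_apply]
  calc σ • Q = σ • e (e.symm Q) := by rw [e.apply_symm_apply]
    _ = e (σ • e.symm Q) := (he σ _).symm
    _ = e (e.symm ((Multiplicative.toAdd α) Q)) := by rw [h1]
    _ = (Multiplicative.toAdd α) Q := e.apply_symm_apply _

/-- **`ρ̄_{E₁,n}` onto ⟺ `ρ̄_{E₂,n}` onto** for `Γ_ℚ`-isomorphic `E₁[n] ≃ E₂[n]`. [folklore] -/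
theorem hasSurjectiveModNGaloisRep_iff_of_torsionIso {W₁ W₂ : WeierstrassCurve ℚ} {n : ℤ}
    (e : geomTorsion W₁ n ≃+ geomTorsion W₂ n)
    (he : ∀ (σ : Field.absoluteGaloisGroup ℚ) (P : geomTorsion W₁ n), e (σ • P) = σ • e P) :
    W₁.HasSurjectiveModNGaloisRep n ↔ W₂.HasSurjectiveModNGaloisRep n :=
  ⟨hasSurjectiveModNGaloisRep_of_torsionIso e he,
    hasSurjectiveModNGaloisRep_of_torsionIso e.symm (torsionIso_symm_smul e he)⟩

variable {W₁ W₂ : WeierstrassCurve ℚ} {p : ℕ} [Fact p.Prime]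

/-- **The small-image obstruction is congruence-invariant**: if `E₁[p] ≃ E₂[p]` as `Γ_ℚ`-modules
and `ρ̄_{E₁,p}` is irreducible but NOT onto (the image condition of O8 / X9 / X10b), then so is
`ρ̄_{E₂,p}`. Irreducibility: Greenberg–Vatsal 2000 (`hasIrreducibleModPGaloisRep_of_torsionIso`);
surjectivity: `hasSurjectiveModNGaloisRep_iff_of_torsionIso`. So no congruent partner of an O8
curve (CM partner, level-lowered curve, Hida-branch member) has big image at `p`.
[cite: Serre1972, §2.4 Prop. 15] -/
theorem irr_and_not_surj_of_torsionIso (e : geomTorsion W₁ (p : ℤ) ≃+ geomTorsion W₂ (p : ℤ))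
    (he : ∀ (σ : Field.absoluteGaloisGroup ℚ) (P : geomTorsion W₁ (p : ℤ)), e (σ • P) = σ • e P)
    (hirr : Irr W₁ p) (hns : ¬ Surj W₁ p) : Irr W₂ p ∧ ¬ Surj W₂ p :=
  ⟨GreenbergVatsal2000.hasIrreducibleModPGaloisRep_of_torsionIso e he hirr,
    fun h ↦ hns ((hasSurjectiveModNGaloisRep_iff_of_torsionIso e he).mpr h)⟩

/-- **No congruent partner carries a useful Galois element**: under the same hypotheses, with `E₂`
elliptic, Kato's Thm. 13.4 (3) / Mazur–Rubin / Burungale–Castella–Skinner hypothesis (im) fails for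
`E₂` as well (`not_bigIm_of_irr_of_not_surj`, Serre Prop. 15 read backwards). A mod-`p` congruence
can import only small-image theorems (Rubin's CM main conjecture via Greenberg–Vatsal /
Emerton–Pollack–Weston, `X11a/CMPartner.lean`), never a big-image Euler-system bound.
[cite: Serre1972, §2.4 Prop. 15] [cite: BurungaleCastellaSkinner2025, p. 2 hypothesis (im), Rem. 1.1.3 (iii)] -/
theorem not_bigIm_of_torsionIso [W₂.IsElliptic]
    (e : geomTorsion W₁ (p : ℤ) ≃+ geomTorsion W₂ (p : ℤ))
    (he : ∀ (σ : Field.absoluteGaloisGroup ℚ) (P : geomTorsion W₁ (p : ℤ)), e (σ • P) = σ • e P)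
    (hirr : Irr W₁ p) (hns : ¬ Surj W₁ p) : ¬ BigIm W₂ p :=
  not_bigIm_of_irr_of_not_surj W₂ p (irr_and_not_surj_of_torsionIso e he hirr hns).1
    (irr_and_not_surj_of_torsionIso e he hirr hns).2

/-- **A curve with SURJECTIVE `ρ̄_{E,p}` is congruent mod `p` to no curve with non-surjective `ρ̄`**
(read for N11, `surj(3)`: no congruence `E[3] ≃ A[3]` with any `A` whose mod-`3` image is proper —
e.g. a CM curve, once "CM ⟹ `ρ̄_{A,3}` not onto" is supplied as the hypothesis `hA`; the kernel
half of the remark that Kim 2025 Conj. 7.5's clause "not congruent to an anomalous ordinary CM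
form" is automatic on N11, PLAN R3-9). [folklore] -/
theorem not_torsionIso_of_surj_of_not_surj (hsurj : Surj W₁ p) (hA : ¬ Surj W₂ p) :
    ¬ ∃ e : geomTorsion W₁ (p : ℤ) ≃+ geomTorsion W₂ (p : ℤ),
      ∀ (σ : Field.absoluteGaloisGroup ℚ) (P : geomTorsion W₁ (p : ℤ)), e (σ • P) = σ • e P := by
  rintro ⟨e, he⟩
  exact hA ((hasSurjectiveModNGaloisRep_iff_of_torsionIso e he).mp hsurj)

end Summit.BirchSwinnertonDyer.Rank1Residual.GaloisImage

end
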